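import Summits.Ventures.CertifiedManyBodySolver.Observables.BraggWeightSymmetry
import HarnessLib

/-!
# Atomic spectral measures: trigonometric-polynomial correlation functions and their Bragg weights

HONEST FRAMING: first certified bounds; not a superconductivity verdict; every number certified or labelled float.

Speedrun `mbsolver`, seat sr-mbsolver-lit-1 (literature team), gen 11.  Pure harmonic analysis; zero compute;
no state, no certificate, no named fact, no number of record.  Written to make the DICTIONARY of
`HOME/lit/stripe_print_comparator_D2.md` §1 (printed one-point stripe profiles ↦ implied Bragg weights, the
context for the certified per-arm ceilings of `Observables/BraggWeightSymmetry.lean`) a kernel statement, and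
to give the `braggWeight` API (`Observables/StripeOrderKernels.lean`) non-vacuous examples with KNOWN Bragg
weights.

## Content

* `wavePoint k : EuclideanSpace ℝ (Fin d)` — the point of `ℝᵈ` with coordinates `k`; `wavePoint k ∈ braggSet k`,
  and for `k`, `Q` in the cell `(−π, π]ᵈ`: `wavePoint k ∈ braggSet Q ↔ k = Q` (`wavePoint_mem_braggSet_iff`).
* `atomicMeasure k w = Σₗ wₗ • δ_{wavePoint (k l)}` for finitely many wavevectors `k l` and weights `w l : ℝ≥0`
  (a finite measure), and the trigonometric polynomial `trigPoly k w r = Σₗ wₗ e^{i r·kₗ}` on `ℤᵈ`.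
* `integral_exp_atomicMeasure` : the atomic measure REPRESENTS `trigPoly k w` in the sense used throughout the
  Bragg-weight files (`∫ exp (i r·ξ) dμ = C r`, the conclusion of Herglotz's theorem).
* `braggWeight_atomicMeasure_single` / `_atom` / `_eq_zero` : for atoms in the cell `(−π, π]ᵈ` the Bragg weight
  at `Q` is the total weight of the atoms AT `Q` (no aliasing inside the cell); with pairwise-distinct atoms it is
  `w l₀` at `Q = k l₀` and `0` off the list.
* `braggWeight_eq_of_represents_trigPoly` / `braggWeight_eq_zero_of_represents_trigPoly` : by the
  representation-independence of Bragg weights (`braggWeight_single_eq_of_representing`, Wiener) the same values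
  hold for EVERY finite measure representing a trigonometric-polynomial correlation function.
* d = 2, the M3 charge star `chargeStar = ((π/4,0), (−π/4,0), (0,π/4), (0,−π/4))`: the UNIDIRECTIONAL period-8
  stripe spectrum `atomicMeasure chargeStar ![a, a, 0, 0]` represents `r ↦ 2a cos(π r₀/4)` and has arm weights
  `a, a, 0, 0` and star weight `2a`; its D₄ ORBIT MEAN (the eight maps of `Transport/D4VecAction.lean` §1 written
  out) is `r ↦ a cos(π r₀/4) + a cos(π r₁/4)`, represented by `atomicMeasure chargeStar ![a/2, a/2, a/2, a/2]`,
  with EVERY arm weight `a/2` and the same star weight `2a` (`orbitMean_stripeX_trigPoly`,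
  `braggWeight_stripeXOrbit_arm`).  This is the factor behind 'per-arm = |f̂(Q)|²/2 for a unidirectional
  pattern' in the comparator file: a collinear modulation of amplitude `A` (so `a = A²/4`) has per-arm orbit-mean
  Bragg weight `A²/8`.

## Not here

The finite-Fourier identity "autocorrelation of a periodic one-point pattern `f` = `trigPoly` with weights
`|f̂(k)|²` on the dual grid" is standard and is NOT formalised in this file (the comparator's two numerical
implementations compute exactly those weights); nothing about a Hubbard state, a row, or a certificate.
-/

noncomputable section

namespace Summit.Ventures.CertifiedManyBodySolver.Observables

open MeasureTheory Complex Filter Topology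
open scoped Real BigOperators NNReal ENNReal

/-! ### §1. Points of `ℝᵈ`, membership in Bragg sets -/

section General

variable {d : ℕ}

/-- The point of `ℝᵈ = EuclideanSpace ℝ (Fin d)` with coordinate vector `k`. -/
def wavePoint (k : Fin d → ℝ) : EuclideanSpace ℝ (Fin d) := WithLp.toLp 2 k

/-- Coordinates of `wavePoint k`. -/
@[simp] theorem wavePoint_apply (k : Fin d → ℝ) (i : Fin d) : wavePoint k i = k i := by
  simp [wavePoint]

/-- `wavePoint k ∈ k + 2πℤᵈ` (take `m = 0`). -/
theorem wavePoint_mem_braggSet_self (k : Fin d → ℝ) : wavePoint k ∈ braggSet k :=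
  ⟨0, fun i => by simp⟩

/-- Inside the cell `(−π, π]ᵈ` there is no aliasing: `wavePoint k ∈ Q + 2πℤᵈ ↔ k = Q`. -/
theorem wavePoint_mem_braggSet_iff {k Q : Fin d → ℝ} (hk : ∀ i, k i ∈ Set.Ioc (-π) π)
    (hQ : ∀ i, Q i ∈ Set.Ioc (-π) π) : wavePoint k ∈ braggSet Q ↔ k = Q := by
  constructor
  · intro hmem
    by_contra hne
    exact Set.disjoint_left.mp (disjoint_braggSet_of_mem_Ioc hk hQ hne)
      (wavePoint_mem_braggSet_self k) hmem
  · rintro rfl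
    exact wavePoint_mem_braggSet_self k

/-! ### §2. Atomic measures and trigonometric polynomials -/

variable {m : ℕ}

/-- The finite ATOMIC measure `Σₗ wₗ δ_{kₗ}` on `ℝᵈ` with atoms at the wavevectors `k l` and weights `w l ≥ 0`. -/
def atomicMeasure (k : Fin m → (Fin d → ℝ)) (w : Fin m → ℝ≥0) : Measure (EuclideanSpace ℝ (Fin d)) :=
  ∑ l, w l • Measure.dirac (wavePoint (k l))

/-- The trigonometric polynomial `C(r) = Σₗ wₗ e^{i r·kₗ}` on `ℤᵈ` (a correlation function with pure point
spectrum; e.g. the translation-averaged autocorrelation of a periodic one-point pattern, with `wₗ = |f̂(kₗ)|²`). -/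
def trigPoly (k : Fin m → (Fin d → ℝ)) (w : Fin m → ℝ≥0) (r : Fin d → ℤ) : ℂ :=
  ∑ l, (w l : ℂ) * exp ((∑ i, (r i : ℝ) * k l i : ℝ) * I)

variable (k : Fin m → (Fin d → ℝ)) (w : Fin m → ℝ≥0)

/-- Mass of a measurable set under the atomic measure: the total weight of the atoms it contains. -/
theorem atomicMeasure_apply {s : Set (EuclideanSpace ℝ (Fin d))} (hs : MeasurableSet s) :
    atomicMeasure k w s = ∑ l, (w l : ℝ≥0∞) * s.indicator 1 (wavePoint (k l)) := by
  simp only [atomicMeasure, Measure.coe_finsetSum, Finset.sum_apply, Measure.smul_apply,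
    Measure.dirac_apply' _ hs, ENNReal.smul_def, smul_eq_mul]

/-- The atomic measure is finite (total mass `Σₗ wₗ`). -/
instance atomicMeasure.isFiniteMeasure : IsFiniteMeasure (atomicMeasure k w) := by
  refine ⟨?_⟩
  rw [atomicMeasure_apply k w MeasurableSet.univ]
  exact ENNReal.sum_lt_top.mpr fun l _ => ENNReal.mul_lt_top ENNReal.coe_lt_top (by simp)

/-- **Atomic measures represent trigonometric polynomials**: `∫ e^{i r·ξ} d(Σₗ wₗ δ_{kₗ})(ξ) = Σₗ wₗ e^{i r·kₗ}`
— the representation hypothesis `hμ` of the Wiener / kernel-ceiling files, for `C = trigPoly k w`. -/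
theorem integral_exp_atomicMeasure (r : Fin d → ℤ) :
    ∫ ξ, exp ((∑ i, (r i : ℝ) * ξ i : ℝ) * I) ∂(atomicMeasure k w) = trigPoly k w r := by
  have hcont : Continuous fun ξ : EuclideanSpace ℝ (Fin d) => exp ((∑ i, (r i : ℝ) * ξ i : ℝ) * I) := by
    fun_prop
  have hint : ∀ l, Integrable (fun ξ : EuclideanSpace ℝ (Fin d) => exp ((∑ i, (r i : ℝ) * ξ i : ℝ) * I))
      (w l • Measure.dirac (wavePoint (k l))) := fun l => by
    refine Integrable.mono' (integrable_const (1 : ℝ)) hcont.aestronglyMeasurable (ae_of_all _ fun ξ => ?_)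
    rw [Complex.norm_exp_ofReal_mul_I]
  unfold atomicMeasure trigPoly
  rw [integral_finsetSum_measure fun l _ => hint l]
  refine Finset.sum_congr rfl fun l _ => ?_
  rw [integral_smul_nnreal_measure, integral_dirac' _ _ hcont.stronglyMeasurable]
  simp [NNReal.smul_def, Complex.real_smul]

/-- The same, packaged as the `∀ r` representation hypothesis. -/
theorem atomicMeasure_represents_trigPoly :
    ∀ r : Fin d → ℤ, ∫ ξ, exp ((∑ i, (r i : ℝ) * ξ i : ℝ) * I) ∂(atomicMeasure k w) = trigPoly k w r :=
  integral_exp_atomicMeasure k w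

/-! ### §3. Bragg weights of atomic measures (atoms in the cell `(−π, π]ᵈ`) -/

/-- **Bragg weight of an atomic measure**: with all atoms and `Q` in `(−π, π]ᵈ`, the Bragg weight at `Q` is the
total weight of the atoms sitting exactly at `Q`. -/
theorem braggWeight_atomicMeasure_single (hk : ∀ l i, k l i ∈ Set.Ioc (-π) π) {Q : Fin d → ℝ}
    (hQ : ∀ i, Q i ∈ Set.Ioc (-π) π) :
    braggWeight (atomicMeasure k w) ![Q] = ∑ l, if k l = Q then (w l : ℝ) else 0 := by
  rw [braggWeight_single, Measure.real, atomicMeasure_apply k w (measurableSet_braggSet Q),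
    ENNReal.toReal_sum (fun l _ => ?_)]
  · refine Finset.sum_congr rfl fun l _ => ?_
    by_cases h : k l = Q
    · rw [if_pos h, Set.indicator_of_mem ((wavePoint_mem_braggSet_iff (hk l) hQ).mpr h)]
      simp
    · rw [if_neg h, Set.indicator_of_notMem (fun hmem => h ((wavePoint_mem_braggSet_iff (hk l) hQ).mp hmem))]
      simp
  · have h1 : (braggSet Q).indicator (1 : EuclideanSpace ℝ (Fin d) → ℝ≥0∞) (wavePoint (k l)) ≤ 1 :=
      Set.indicator_le_self _ _ _
    exact ENNReal.mul_ne_top ENNReal.coe_ne_top (ne_top_of_le_ne_top ENNReal.one_ne_top h1)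

/-- With pairwise-distinct atoms, the Bragg weight at the atom `k l₀` is its weight `w l₀`. -/
theorem braggWeight_atomicMeasure_atom (hk : ∀ l i, k l i ∈ Set.Ioc (-π) π)
    (hinj : Function.Injective k) (l₀ : Fin m) :
    braggWeight (atomicMeasure k w) ![k l₀] = w l₀ := by
  rw [braggWeight_atomicMeasure_single k w hk (hk l₀)]
  rw [Finset.sum_eq_single l₀ (fun l _ hl => if_neg fun h => hl (hinj h)) (fun h => absurd (Finset.mem_univ _) h)]
  rw [if_pos rfl]

/-- Off the list of atoms the Bragg weight vanishes. -/
theorem braggWeight_atomicMeasure_eq_zero (hk : ∀ l i, k l i ∈ Set.Ioc (-π) π) {Q : Fin d → ℝ}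
    (hQ : ∀ i, Q i ∈ Set.Ioc (-π) π) (hQk : ∀ l, k l ≠ Q) :
    braggWeight (atomicMeasure k w) ![Q] = 0 := by
  rw [braggWeight_atomicMeasure_single k w hk hQ]
  exact Finset.sum_eq_zero fun l _ => if_neg (hQk l)

/-! ### §4. Representation independence: any measure representing a trigonometric polynomial -/

variable {k w}

/-- **Dictionary, measure-free form.**  If a finite measure `μ` represents the trigonometric polynomial
`Σₗ wₗ e^{i r·kₗ}` (atoms pairwise distinct, in `(−π, π]ᵈ`), then its Bragg weight at `kₗ₀` is `wₗ₀` — whatever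
`μ` is (Wiener: Bragg weights are limits of structure-factor means of `C` alone). -/
theorem braggWeight_eq_of_represents_trigPoly (μ : Measure (EuclideanSpace ℝ (Fin d))) [IsFiniteMeasure μ]
    (hμ : ∀ r : Fin d → ℤ, ∫ ξ, exp ((∑ i, (r i : ℝ) * ξ i : ℝ) * I) ∂μ = trigPoly k w r)
    (hk : ∀ l i, k l i ∈ Set.Ioc (-π) π) (hinj : Function.Injective k) (l₀ : Fin m) :
    braggWeight μ ![k l₀] = w l₀ := by
  rw [braggWeight_single_eq_of_representing μ hμ (atomicMeasure k w) (atomicMeasure_represents_trigPoly k w)]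
  exact braggWeight_atomicMeasure_atom k w hk hinj l₀

/-- Measure-free form off the atoms: a measure representing `Σₗ wₗ e^{i r·kₗ}` has no Bragg weight at any cell
wavevector `Q ∉ {kₗ}`. -/
theorem braggWeight_eq_zero_of_represents_trigPoly (μ : Measure (EuclideanSpace ℝ (Fin d))) [IsFiniteMeasure μ]
    (hμ : ∀ r : Fin d → ℤ, ∫ ξ, exp ((∑ i, (r i : ℝ) * ξ i : ℝ) * I) ∂μ = trigPoly k w r)
    (hk : ∀ l i, k l i ∈ Set.Ioc (-π) π) {Q : Fin d → ℝ} (hQ : ∀ i, Q i ∈ Set.Ioc (-π) π)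
    (hQk : ∀ l, k l ≠ Q) : braggWeight μ ![Q] = 0 := by
  rw [braggWeight_single_eq_of_representing μ hμ (atomicMeasure k w) (atomicMeasure_represents_trigPoly k w)]
  exact braggWeight_atomicMeasure_eq_zero k w hk hQ hQk

end General

/-! ### §5. The M3 charge star (`d = 2`): a unidirectional period-8 stripe spectrum and its D₄ orbit mean -/

section ChargeStar

/-- Weights of the UNIDIRECTIONAL `x`-stripe spectrum on the charge star: `a` at `(±π/4, 0)`, `0` at `(0, ±π/4)`. -/
def stripeXWt (a : ℝ≥0) : Fin 4 → ℝ≥0 := ![a, a, 0, 0]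

/-- Weights of its D₄ ORBIT MEAN: `a/2` on each of the four arms. -/
def stripeXOrbitWt (a : ℝ≥0) : Fin 4 → ℝ≥0 := ![a / 2, a / 2, a / 2, a / 2]

/-- The charge-star arms lie in the cell, in the `∀ l i` form used above. -/
theorem chargeStar_mem_Ioc' : ∀ (l : Fin 4) (i : Fin 2), chargeStar l i ∈ Set.Ioc (-π) π :=
  chargeStar_mem_Ioc

/-- The unidirectional `x`-stripe correlation function is `C(r) = 2a cos(π r₀/4)`. -/
theorem trigPoly_stripeX (a : ℝ≥0) (r : Fin 2 → ℤ) :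
    trigPoly chargeStar (stripeXWt a) r = 2 * (a : ℝ) * Real.cos (π * r 0 / 4) := by
  unfold trigPoly stripeXWt
  simp only [Fin.sum_univ_four, Fin.sum_univ_two, chargeStar, Matrix.cons_val_zero, Matrix.cons_val_one,
    Matrix.cons_val, NNReal.coe_zero, Complex.ofReal_zero, zero_mul, add_zero]
  have h1 : ((r 0 : ℝ) * (π / 4) + (r 1 : ℝ) * 0 : ℝ) = π * r 0 / 4 := by ring
  have h2 : ((r 0 : ℝ) * -(π / 4) + (r 1 : ℝ) * 0 : ℝ) = -(π * r 0 / 4) := by ring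
  rw [h1, h2, Complex.ofReal_cos, Complex.cos, Complex.ofReal_neg, neg_mul]
  push_cast
  ring

/-- Its D₄ orbit mean is `C̄(r) = a cos(π r₀/4) + a cos(π r₁/4)`. -/
theorem trigPoly_stripeXOrbit (a : ℝ≥0) (r : Fin 2 → ℤ) :
    trigPoly chargeStar (stripeXOrbitWt a) r
      = (a : ℝ) * Real.cos (π * r 0 / 4) + (a : ℝ) * Real.cos (π * r 1 / 4) := by
  unfold trigPoly stripeXOrbitWt
  simp only [Fin.sum_univ_four, Fin.sum_univ_two, chargeStar, Matrix.cons_val_zero, Matrix.cons_val_one,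
    Matrix.cons_val, NNReal.coe_div, NNReal.coe_ofNat]
  have h1 : ((r 0 : ℝ) * (π / 4) + (r 1 : ℝ) * 0 : ℝ) = π * r 0 / 4 := by ring
  have h2 : ((r 0 : ℝ) * -(π / 4) + (r 1 : ℝ) * 0 : ℝ) = -(π * r 0 / 4) := by ring
  have h3 : ((r 0 : ℝ) * 0 + (r 1 : ℝ) * (π / 4) : ℝ) = π * r 1 / 4 := by ring
  have h4 : ((r 0 : ℝ) * 0 + (r 1 : ℝ) * -(π / 4) : ℝ) = -(π * r 1 / 4) := by ring
  rw [h1, h2, h3, h4, Complex.ofReal_cos, Complex.ofReal_cos, Complex.cos, Complex.cos]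
  push_cast
  ring

/-- **The orbit mean, written out.**  Averaging the unidirectional stripe correlation function over the eight
point-group images of `r` (the maps of `Transport/D4VecAction.lean` §1: identity, `(−r₁, r₀)`, `(−r₀, −r₁)`,
`(r₁, −r₀)`, `(r₀, −r₁)`, `(−r₁, −r₀)`, `(−r₀, r₁)`, `(r₁, r₀)`) gives the orbit-mean trigonometric polynomial:
each star arm receives HALF of the unidirectional atom weight. -/
theorem orbitMean_stripeX_trigPoly (a : ℝ≥0) (r : Fin 2 → ℤ) :
    (8 : ℂ)⁻¹ * (trigPoly chargeStar (stripeXWt a) ![r 0, r 1]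
        + trigPoly chargeStar (stripeXWt a) ![-r 1, r 0]
        + trigPoly chargeStar (stripeXWt a) ![-r 0, -r 1]
        + trigPoly chargeStar (stripeXWt a) ![r 1, -r 0]
        + trigPoly chargeStar (stripeXWt a) ![r 0, -r 1]
        + trigPoly chargeStar (stripeXWt a) ![-r 1, -r 0]
        + trigPoly chargeStar (stripeXWt a) ![-r 0, r 1]
        + trigPoly chargeStar (stripeXWt a) ![r 1, r 0])
      = trigPoly chargeStar (stripeXOrbitWt a) r := by
  simp only [trigPoly_stripeX, trigPoly_stripeXOrbit, Matrix.cons_val_zero, Int.cast_neg]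
  have hc0 : Real.cos (π * -(r 0 : ℝ) / 4) = Real.cos (π * r 0 / 4) := by
    rw [← Real.cos_neg]; congr 1; ring
  have hc1 : Real.cos (π * -(r 1 : ℝ) / 4) = Real.cos (π * r 1 / 4) := by
    rw [← Real.cos_neg]; congr 1; ring
  rw [hc0, hc1]
  push_cast
  ring

variable (a : ℝ≥0)

/-- Unidirectional stripe: Bragg weight `a` on the arm `(π/4, 0)`. -/
theorem braggWeight_stripeX_arm0 :
    braggWeight (atomicMeasure chargeStar (stripeXWt a)) ![![π / 4, 0]] = a := by
  have e0 : (![π / 4, 0] : Fin 2 → ℝ) = chargeStar 0 := by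
    ext i; fin_cases i <;> simp [chargeStar]
  rw [e0, braggWeight_atomicMeasure_atom chargeStar (stripeXWt a) chargeStar_mem_Ioc' chargeStar_injective 0]
  simp [stripeXWt]

/-- Unidirectional stripe: NO Bragg weight on the perpendicular arm `(0, π/4)`. -/
theorem braggWeight_stripeX_arm2 :
    braggWeight (atomicMeasure chargeStar (stripeXWt a)) ![![0, π / 4]] = 0 := by
  have e2 : (![0, π / 4] : Fin 2 → ℝ) = chargeStar 2 := by
    ext i; fin_cases i <;> simp [chargeStar]
  rw [e2, braggWeight_atomicMeasure_atom chargeStar (stripeXWt a) chargeStar_mem_Ioc' chargeStar_injective 2]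
  simp [stripeXWt]

/-- Unidirectional stripe: total star weight `2a`. -/
theorem braggWeight_stripeX_star :
    braggWeight (atomicMeasure chargeStar (stripeXWt a)) chargeStar = 2 * a := by
  rw [braggWeight_eq_sum_single _ chargeStar chargeStar_pairwise_disjoint, Fin.sum_univ_four,
    braggWeight_atomicMeasure_atom chargeStar (stripeXWt a) chargeStar_mem_Ioc' chargeStar_injective 0,
    braggWeight_atomicMeasure_atom chargeStar (stripeXWt a) chargeStar_mem_Ioc' chargeStar_injective 1,
    braggWeight_atomicMeasure_atom chargeStar (stripeXWt a) chargeStar_mem_Ioc' chargeStar_injective 2,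
    braggWeight_atomicMeasure_atom chargeStar (stripeXWt a) chargeStar_mem_Ioc' chargeStar_injective 3]
  simp [stripeXWt]
  ring

/-- **Orbit mean: every arm carries `a/2`** — the per-arm Bragg weight of the D₄-orbit-mean spectrum of a
unidirectional stripe is HALF the unidirectional atom weight (the factor of the comparator dictionary). -/
theorem braggWeight_stripeXOrbit_arm (l : Fin 4) :
    braggWeight (atomicMeasure chargeStar (stripeXOrbitWt a)) ![chargeStar l] = a / 2 := by
  rw [braggWeight_atomicMeasure_atom chargeStar (stripeXOrbitWt a) chargeStar_mem_Ioc' chargeStar_injective l]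
  fin_cases l <;> simp [stripeXOrbitWt]

/-- Orbit mean: the star total is unchanged, `2a`; consistent with `chargeStar_braggWeight_eq_four_mul`
(`4 · (a/2) = 2a`). -/
theorem braggWeight_stripeXOrbit_star :
    braggWeight (atomicMeasure chargeStar (stripeXOrbitWt a)) chargeStar = 2 * a := by
  rw [braggWeight_eq_sum_single _ chargeStar chargeStar_pairwise_disjoint, Fin.sum_univ_four,
    braggWeight_stripeXOrbit_arm, braggWeight_stripeXOrbit_arm, braggWeight_stripeXOrbit_arm,
    braggWeight_stripeXOrbit_arm]
  ring

/-- Measure-free reading for the orbit mean: ANY finite measure representing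
`C̄(r) = a cos(π r₀/4) + a cos(π r₁/4)` has Bragg weight `a/2` on each charge arm — in particular on
`(π/4, 0)`, the arm of the certified per-arm ceilings `chargeArm_le_r262` / `_r258`. -/
theorem braggWeight_arm_of_represents_stripeXOrbit (μ : Measure (EuclideanSpace ℝ (Fin 2))) [IsFiniteMeasure μ]
    (hμ : ∀ r : Fin 2 → ℤ, ∫ ξ, exp ((∑ i, (r i : ℝ) * ξ i : ℝ) * I) ∂μ
      = ((a : ℝ) * Real.cos (π * r 0 / 4) + (a : ℝ) * Real.cos (π * r 1 / 4) : ℝ)) :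
    braggWeight μ ![![π / 4, 0]] = a / 2 := by
  have hμ' : ∀ r : Fin 2 → ℤ, ∫ ξ, exp ((∑ i, (r i : ℝ) * ξ i : ℝ) * I) ∂μ
      = trigPoly chargeStar (stripeXOrbitWt a) r := fun r => by
    rw [hμ r, trigPoly_stripeXOrbit]; push_cast; ring
  have e0 : (![π / 4, 0] : Fin 2 → ℝ) = chargeStar 0 := by
    ext i; fin_cases i <;> simp [chargeStar]
  rw [e0, braggWeight_eq_of_represents_trigPoly μ hμ' chargeStar_mem_Ioc' chargeStar_injective 0]
  simp [stripeXOrbitWt]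

end ChargeStar

end Summit.Ventures.CertifiedManyBodySolver.Observables
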